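/-
Origin: expansion seat `planner-pub-hodgecm-pv11-g2-0`, handover 2026-08-18 (`HOME/pub-hodgecm-pv11-g2/lean/Pv11g2/LatticeTheta.lean`, md5 21ea7652, 333 lines);
landed by the gen-6 packager in gate run 22 as `HodgeCM/PerL34/LatticeTheta.lean` (stripped 6 #print/#check/#eval lines).
-/
import Mathlib.Analysis.Distribution.SchwartzSpace.Basic
import Mathlib.Algebra.Module.ZLattice.Summable
import Mathlib.Analysis.Normed.Group.Tannery
import Mathlib.Analysis.Normed.Group.FunctionSeries

/-!
# Schwartz functions summed over a `ℤ`-lattice: the archimedean theta kernel (KERNEL, Mathlib-only)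

Unit `pub-hodgecm-pv11-g2` (DAG node #11, gen 2).  Proposed final place:
`HodgeCM/PerL34/LatticeTheta.lean` (imports `Mathlib.*` only).

## What this file makes KERNEL

In the seesaw shell `HodgeCM.PerL34.Seesaw.ThetaSeesawData` (node N17) and in the supply route (E)
(`HodgeCM.PerL34.SupplyElementary`, `…SupplyDictionary.SupplyBridge`) the archimedean input is
carried as *hypotheses*:

* `ThetaSeesawData.AbsSummable₁/₂ : ∀ ψ, Summable fun x => ‖ev ψ x‖` — absolute convergence of the
  theta series (there a PRINT leaf: Reiter, LNM 1382, §2.14 and §4.7; Weil, Acta Math. 111 (1964),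
  nos 17–18);
* the SETUP block `(Λ, ℓ, hℓ0, hℓ, F, hF)` of `SupplyElementary.supply₁/₂_of_lattice` /
  `SupplyBridge`: an additive group `Λ` with an `ℕ`-valued size `ℓ` (`ℓ v = 0 ↔ v = 0`,
  `ℓ (N • v) = N * ℓ v`) and an absolutely summable `F : Λ → ℂ`.

Here we PROVE these, from Mathlib alone, in the archimedean-lattice dictionary

  `X := L` a discrete `ℤ`-submodule of a finite-dimensional real normed space `E`,
  `ev ψ v := ψ (x + v)` for a Schwartz function `ψ : 𝓢(E, F)` and a base point `x : E`,
  `F v := f (x₀ + v)`, `ℓ := latticeSize b` for a `ℤ`-basis `b` of `L`.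

Main results (all complete — no placeholders; axioms = the Lean trio):

* `norm_translate_le` — the Peetre–Schwartz majorant
  `‖f (x + w)‖ ≤ C * (1 + ‖x‖) ^ k * (1 + ‖w‖)⁻¹ ^ k` with `Summable fun v : L => (1 + ‖v‖)⁻¹ ^ k`;
* `summable_norm_translate` (T1) — `Summable fun v : L => ‖f (x + v)‖` (this IS `AbsSummable`/`hF`);
* `tsum_translate_add_mem` / `exists_tsum_norm_translate_le` (T2) — `L`-periodicity of
  `x ↦ ∑' v : L, f (x + v)` and, for a full lattice, a bound uniform in `x`;
* `continuous_tsum_translate` (T3) — continuity of `x ↦ ∑' v : L, f (x + v)`;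
* `tendsto_tsum_translate_nsmul` (T4) — `∑' v : L, f (x₀ + N • v) ⟶ f x₀` as `N → ∞`
  (Tannery / dominated convergence with the Schwartz majorant), hence
  `eventually_tsum_translate_nsmul_ne_zero` when `f x₀ ≠ 0` — the "thinned theta value is
  eventually non-zero" step of route (E);
* `latticeSize`, `latticeSize_eq_zero_iff`, `latticeSize_nsmul`, `exists_latticeSize` — the size
  function `(ℓ, hℓ0, hℓ)` for ANY finite free `ℤ`-module (so for `L`).

No statement of the 2001 programme, of PerL or of QW8 is used or cited: everything below is
elementary analysis on `𝓢(E, F)` and `ZLattice`.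
-/

set_option autoImplicit false

noncomputable section

open Filter Topology Module
open scoped SchwartzMap

namespace HodgeCM
namespace PerL34
namespace LatticeTheta

/-! ### The size function of a finite free `ℤ`-module -/

section Size

variable {Λ ι : Type*} [AddCommGroup Λ] [Fintype ι]

/-- The `ℓ¹`-size of `v` in the coordinates of a `ℤ`-basis `b`. -/
def latticeSize (b : Basis ι ℤ Λ) (v : Λ) : ℕ := ∑ i, (b.repr v i).natAbs

/-- (Ported verbatim from the HodgeCMPerL package; no docstring in the source.) -/
theorem latticeSize_eq_zero_iff (b : Basis ι ℤ Λ) (v : Λ) : latticeSize b v = 0 ↔ v = 0 := by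
  unfold latticeSize
  rw [Finset.sum_eq_zero_iff]
  constructor
  · intro h
    apply b.repr.injective
    rw [map_zero]
    ext i
    simpa using h i (Finset.mem_univ i)
  · rintro rfl i -
    simp

/-- (Ported verbatim from the HodgeCMPerL package; no docstring in the source.) -/
theorem latticeSize_nsmul (b : Basis ι ℤ Λ) (N : ℕ) (v : Λ) :
    latticeSize b (N • v) = N * latticeSize b v := by
  unfold latticeSize
  rw [Finset.mul_sum]
  refine Finset.sum_congr rfl fun i _ => ?_
  simp [Int.natAbs_mul]

/-- Every finite free `ℤ`-module carries a size function as required by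
`SupplyElementary.tendsto_tsum_nsmul` / `supply₁_of_lattice` (hypotheses `ℓ, hℓ0, hℓ`). -/
theorem exists_latticeSize (Λ : Type*) [AddCommGroup Λ] [Module.Free ℤ Λ] [Module.Finite ℤ Λ] :
    ∃ ℓ : Λ → ℕ, (∀ v, ℓ v = 0 ↔ v = 0) ∧ ∀ (N : ℕ) (v : Λ), ℓ (N • v) = N * ℓ v :=
  ⟨latticeSize (Module.Free.chooseBasis ℤ Λ), latticeSize_eq_zero_iff _, latticeSize_nsmul _⟩

end Size

/-! ### Peetre's inequality and the Schwartz majorant -/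

section Peetre

variable {E : Type*} [NormedAddCommGroup E]

/-- Peetre's inequality (additive form). -/
theorem one_add_norm_le_mul (x w : E) : 1 + ‖w‖ ≤ (1 + ‖x‖) * (1 + ‖x + w‖) := by
  have h1 : ‖w‖ ≤ ‖x‖ + ‖x + w‖ := by
    calc ‖w‖ = ‖(x + w) - x‖ := by rw [add_sub_cancel_left]
      _ ≤ ‖x + w‖ + ‖x‖ := norm_sub_le _ _
      _ = ‖x‖ + ‖x + w‖ := add_comm _ _
  nlinarith [norm_nonneg x, norm_nonneg (x + w)]

/-- Peetre's inequality, inverted and raised to the `k`-th power. -/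
theorem inv_one_add_norm_add_pow_le (x w : E) (k : ℕ) :
    (1 + ‖x + w‖)⁻¹ ^ k ≤ (1 + ‖x‖) ^ k * (1 + ‖w‖)⁻¹ ^ k := by
  rw [← mul_pow]
  apply pow_le_pow_left₀ (by positivity)
  have hw : (0 : ℝ) < 1 + ‖w‖ := by positivity
  have hxw : (0 : ℝ) < 1 + ‖x + w‖ := by positivity
  rw [← div_eq_mul_inv, inv_eq_one_div, div_le_div_iff₀ hxw hw, one_mul]
  exact one_add_norm_le_mul x w

end Peetre

section Schwartz

variable {E F : Type*} [NormedAddCommGroup E] [NormedSpace ℝ E]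
  [NormedAddCommGroup F] [NormedSpace ℝ F]

/-- Polynomial decay of a Schwartz function in the form `‖f y‖ ≤ C * (1 + ‖y‖)⁻¹ ^ k`. -/
theorem exists_norm_le_inv_one_add_pow (f : 𝓢(E, F)) (k : ℕ) :
    ∃ C : ℝ, 0 ≤ C ∧ ∀ y : E, ‖f y‖ ≤ C * (1 + ‖y‖)⁻¹ ^ k := by
  set C : ℝ := 2 ^ k * (Finset.Iic (k, 0)).sup (fun m => SchwartzMap.seminorm ℝ m.1 m.2) f
    with hC
  have h : ∀ y : E, (1 + ‖y‖) ^ k * ‖f y‖ ≤ C := fun y => by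
    have := SchwartzMap.one_add_le_sup_seminorm_apply (𝕜 := ℝ) (m := (k, 0)) (k := k) (n := 0)
      le_rfl le_rfl f y
    rwa [norm_iteratedFDeriv_zero] at this
  refine ⟨C, le_trans (by positivity) (h 0), fun y => ?_⟩
  have hy : (0 : ℝ) < (1 + ‖y‖) ^ k := by positivity
  rw [inv_pow, ← div_eq_mul_inv, le_div_iff₀ hy, mul_comm]
  exact h y

/-- The Peetre–Schwartz majorant: `‖f (x + w)‖ ≤ C * (1 + ‖x‖) ^ k * (1 + ‖w‖)⁻¹ ^ k`. -/
theorem exists_norm_translate_le (f : 𝓢(E, F)) (k : ℕ) :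
    ∃ C : ℝ, 0 ≤ C ∧ ∀ x w : E, ‖f (x + w)‖ ≤ C * (1 + ‖x‖) ^ k * (1 + ‖w‖)⁻¹ ^ k := by
  obtain ⟨C, hC, hle⟩ := exists_norm_le_inv_one_add_pow f k
  refine ⟨C, hC, fun x w => (hle (x + w)).trans ?_⟩
  rw [mul_assoc]
  exact mul_le_mul_of_nonneg_left (inv_one_add_norm_add_pow_le x w k) hC

end Schwartz

/-! ### Schwartz functions over a discrete lattice -/

section Lattice

variable {E F : Type*} [NormedAddCommGroup E] [NormedSpace ℝ E] [FiniteDimensional ℝ E]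
  [NormedAddCommGroup F] [NormedSpace ℝ F]
  (L : Submodule ℤ E) [DiscreteTopology L]

/-- `∑_{v ∈ L} (1 + ‖v‖)⁻ᵏ < ∞` for `k > rank L`. -/
theorem summable_inv_one_add_norm_pow {k : ℕ} (hk : Module.finrank ℤ L < k) :
    Summable fun v : L => (1 + ‖(v : E)‖)⁻¹ ^ k := by
  refine Summable.of_norm_bounded_eventually (ZLattice.summable_norm_pow_inv L k hk) ?_
  refine (eventually_cofinite_ne 0).mono fun v hv => ?_
  have hv' : 0 < ‖(v : E)‖ := norm_pos_iff.mpr (by simpa using hv)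
  rw [Real.norm_of_nonneg (by positivity), ← Submodule.coe_norm]
  exact pow_le_pow_left₀ (by positivity) (inv_anti₀ hv' (le_add_of_nonneg_left zero_le_one)) k

/-- The majorant package over the lattice: an exponent `k`, a constant `C` and the summable
dominating family. -/
theorem norm_translate_le (f : 𝓢(E, F)) :
    ∃ (k : ℕ) (C : ℝ), 0 ≤ C ∧ Summable (fun v : L => (1 + ‖(v : E)‖)⁻¹ ^ k) ∧
      ∀ x w : E, ‖f (x + w)‖ ≤ C * (1 + ‖x‖) ^ k * (1 + ‖w‖)⁻¹ ^ k := by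
  obtain ⟨C, hC, hle⟩ := exists_norm_translate_le f (Module.finrank ℤ L + 1)
  exact ⟨_, C, hC, summable_inv_one_add_norm_pow L (Nat.lt_succ_self _), hle⟩

/-- **(T1)** absolute convergence of the theta series `∑_{v ∈ L} f (x + v)` — the kernel form of
`ThetaSeesawData.AbsSummable₁/₂` and of the hypothesis `hF` of `SupplyElementary.supply₁/₂_of_lattice`
in the archimedean-lattice dictionary. -/
theorem summable_norm_translate (f : 𝓢(E, F)) (x : E) :
    Summable fun v : L => ‖f (x + (v : E))‖ := by
  obtain ⟨k, C, hC, hsum, hle⟩ := norm_translate_le L f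
  exact Summable.of_nonneg_of_le (fun _ => norm_nonneg _) (fun v => hle x v)
    (hsum.mul_left (C * (1 + ‖x‖) ^ k))

/-- (Ported verbatim from the HodgeCMPerL package; no docstring in the source.) -/
theorem summable_translate [CompleteSpace F] (f : 𝓢(E, F)) (x : E) :
    Summable fun v : L => f (x + (v : E)) :=
  .of_norm (summable_norm_translate L f x)

/-- The theta series restricted to the lattice itself (`x = 0`). -/
theorem summable_norm_restrict (f : 𝓢(E, F)) : Summable fun v : L => ‖f (v : E)‖ := by
  simpa using summable_norm_translate L f 0

/-- A locally uniform bound: on the ball `‖x‖ ≤ R` the terms are dominated by a summable family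
independent of `x`. -/
theorem exists_dominated_on_ball (f : 𝓢(E, F)) (R : ℝ) :
    ∃ u : L → ℝ, Summable u ∧ ∀ x : E, ‖x‖ ≤ R → ∀ v : L, ‖f (x + (v : E))‖ ≤ u v := by
  obtain ⟨k, C, hC, hsum, hle⟩ := norm_translate_le L f
  refine ⟨fun v => C * (1 + |R|) ^ k * (1 + ‖(v : E)‖)⁻¹ ^ k, hsum.mul_left _, fun x hx v => ?_⟩
  have hxR : ‖x‖ ≤ |R| := hx.trans (le_abs_self R)
  calc ‖f (x + (v : E))‖ ≤ C * (1 + ‖x‖) ^ k * (1 + ‖(v : E)‖)⁻¹ ^ k := hle x v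
    _ ≤ C * (1 + |R|) ^ k * (1 + ‖(v : E)‖)⁻¹ ^ k := by gcongr

/-- **(T3)** the theta function `x ↦ ∑_{v ∈ L} f (x + v)` is continuous. -/
theorem continuous_tsum_translate [CompleteSpace F] (f : 𝓢(E, F)) :
    Continuous fun x : E => ∑' v : L, f (x + (v : E)) := by
  rw [continuous_iff_continuousAt]
  intro x₀
  obtain ⟨u, hu, hle⟩ := exists_dominated_on_ball L f (‖x₀‖ + 1)
  have hOn : ContinuousOn (fun x : E => ∑' v : L, f (x + (v : E))) (Metric.ball x₀ 1) := by
    refine continuousOn_tsum (fun v => ?_) hu fun v x hx => hle x ?_ v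
    · exact (f.continuous.comp (continuous_id.add continuous_const)).continuousOn
    · have hx' : ‖x - x₀‖ < 1 := mem_ball_iff_norm.mp hx
      calc ‖x‖ = ‖x₀ + (x - x₀)‖ := by rw [add_sub_cancel]
        _ ≤ ‖x₀‖ + ‖x - x₀‖ := norm_add_le _ _
        _ ≤ ‖x₀‖ + 1 := by linarith
  exact hOn.continuousAt (Metric.ball_mem_nhds x₀ one_pos)

omit [FiniteDimensional ℝ E] [DiscreteTopology L] in
/-- **(T2a)** `L`-periodicity of the theta function. -/
theorem tsum_translate_add_mem (f : 𝓢(E, F)) (x : E) (w : L) :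
    ∑' v : L, f (x + (w : E) + (v : E)) = ∑' v : L, f (x + (v : E)) := by
  rw [← (Equiv.addLeft w).tsum_eq (fun v : L => f (x + (v : E)))]
  refine tsum_congr fun v => ?_
  simp [add_assoc]

/-- **(T2)** for a full lattice the absolutely convergent theta series is bounded uniformly in the
translation variable (reduce `x` to the bounded fundamental domain by periodicity). -/
theorem exists_tsum_norm_translate_le [IsZLattice ℝ L] (f : 𝓢(E, F)) :
    ∃ M : ℝ, ∀ x : E, ∑' v : L, ‖f (x + (v : E))‖ ≤ M := by
  classical
  let b := (Module.Free.chooseBasis ℤ L).ofZLatticeBasis ℝ L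
  obtain ⟨u, hu, hle⟩ := exists_dominated_on_ball L f (∑ i, ‖b i‖)
  refine ⟨∑' v : L, u v, fun x => ?_⟩
  -- write `x = fract b x + floor b x` with `floor b x ∈ L`
  have hspan : Submodule.span ℤ (Set.range ⇑b) = L :=
    (Module.Free.chooseBasis ℤ L).ofZLatticeBasis_span ℝ
  have hmem : (ZSpan.floor b x : E) ∈ L := hspan.le (ZSpan.floor b x).2
  have hx : x = ZSpan.fract b x + ((⟨_, hmem⟩ : L) : E) := by
    simp [ZSpan.fract_apply]
  have key : ∑' v : L, ‖f (x + (v : E))‖ = ∑' v : L, ‖f (ZSpan.fract b x + (v : E))‖ := by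
    conv_lhs => rw [hx]
    rw [← (Equiv.addLeft (⟨_, hmem⟩ : L)).tsum_eq (fun v : L => ‖f (ZSpan.fract b x + (v : E))‖)]
    refine tsum_congr fun v => ?_
    simp [add_assoc]
  rw [key]
  refine Summable.tsum_le_tsum (fun v => hle _ (ZSpan.norm_fract_le b x) v)
    (summable_norm_translate L f _) hu

/-! ### Thinning the lattice: `N • L` -/

omit [DiscreteTopology L] in
/-- For `v ≠ 0` in `L`, `x₀ + N • v → ∞` (leaves every compact set) as `N → ∞`. -/
theorem tendsto_translate_nsmul_cocompact (x₀ : E) {v : L} (hv : v ≠ 0) :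
    Tendsto (fun N : ℕ => x₀ + ((N • v : L) : E)) atTop (cocompact E) := by
  have hv' : 0 < ‖(v : E)‖ := norm_pos_iff.mpr (by simpa using hv)
  rw [← Metric.cobounded_eq_cocompact, ← tendsto_norm_atTop_iff_cobounded]
  have hlow : ∀ N : ℕ, (N : ℝ) * ‖(v : E)‖ - ‖x₀‖ ≤ ‖x₀ + ((N • v : L) : E)‖ := fun N => by
    have h1 : ‖((N • v : L) : E)‖ = (N : ℝ) * ‖(v : E)‖ := by
      rw [Submodule.coe_smul_of_tower, ← Nat.cast_smul_eq_nsmul ℝ, norm_smul, Real.norm_natCast]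
    have h2 : ‖((N • v : L) : E)‖ ≤ ‖x₀ + ((N • v : L) : E)‖ + ‖x₀‖ := by
      calc ‖((N • v : L) : E)‖ = ‖(x₀ + ((N • v : L) : E)) - x₀‖ := by rw [add_sub_cancel_left]
        _ ≤ ‖x₀ + ((N • v : L) : E)‖ + ‖x₀‖ := norm_sub_le _ _
    linarith
  refine tendsto_atTop_mono hlow ?_
  exact tendsto_atTop_add_const_right _ _
    (Tendsto.atTop_mul_const hv' tendsto_natCast_atTop_atTop)

/-- **(T4)** distribution of the theta kernel along the thinned lattices `N • L`:
`∑_{v ∈ L} f (x₀ + N • v) ⟶ f x₀` as `N → ∞` (dominated convergence with the Schwartz majorant;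
only the term `v = 0` survives). -/
theorem tendsto_tsum_translate_nsmul [CompleteSpace F] (f : 𝓢(E, F)) (x₀ : E) :
    Tendsto (fun N : ℕ => ∑' v : L, f (x₀ + ((N • v : L) : E))) atTop (𝓝 (f x₀)) := by
  classical
  obtain ⟨k, C, hC, hsum, hle⟩ := norm_translate_le L f
  let g : L → F := fun v => if v = 0 then f x₀ else 0
  have hg : ∑' v : L, g v = f x₀ := tsum_ite_eq (0 : L) (fun _ => f x₀)
  rw [← hg]
  refine tendsto_tsum_of_dominated_convergence
    (bound := fun v : L => C * (1 + ‖x₀‖) ^ k * (1 + ‖(v : E)‖)⁻¹ ^ k) (hsum.mul_left _) ?_ ?_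
  · intro v
    by_cases hv : v = 0
    · subst hv
      simp [g]
    · simp only [g, if_neg hv]
      exact (f.tendsto_cocompact).comp (tendsto_translate_nsmul_cocompact L x₀ hv)
  · refine (eventually_ge_atTop 1).mono fun N hN v => ?_
    refine (hle x₀ _).trans ?_
    have hvN : ‖(v : E)‖ ≤ ‖((N • v : L) : E)‖ := by
      rw [Submodule.coe_smul_of_tower, ← Nat.cast_smul_eq_nsmul ℝ, norm_smul, Real.norm_natCast]
      exact le_mul_of_one_le_left (norm_nonneg _) (by exact_mod_cast hN)
    have hpos : (0 : ℝ) < 1 + ‖(v : E)‖ := by positivity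
    gcongr _ * ?_
    exact pow_le_pow_left₀ (by positivity) (inv_anti₀ hpos (by linarith)) k

/-- Hence, if `f x₀ ≠ 0`, the thinned theta value `∑_{v ∈ L} f (x₀ + N • v)` is NON-ZERO for all
large `N` — the kernel form of the "supply" step of route (E) (`SupplyElementary`, hypothesis
block `hval`/`hF0`). -/
theorem eventually_tsum_translate_nsmul_ne_zero [CompleteSpace F] (f : 𝓢(E, F)) (x₀ : E)
    (hx₀ : f x₀ ≠ 0) : ∀ᶠ N : ℕ in atTop, ∑' v : L, f (x₀ + ((N • v : L) : E)) ≠ 0 :=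
  (tendsto_tsum_translate_nsmul L f x₀).eventually_ne hx₀

/-- (Ported verbatim from the HodgeCMPerL package; no docstring in the source.) -/
theorem exists_tsum_translate_nsmul_ne_zero [CompleteSpace F] (f : 𝓢(E, F)) (x₀ : E)
    (hx₀ : f x₀ ≠ 0) : ∃ N : ℕ, 0 < N ∧ ∑' v : L, f (x₀ + ((N • v : L) : E)) ≠ 0 := by
  obtain ⟨N, hN⟩ := ((eventually_gt_atTop 0).and
    (eventually_tsum_translate_nsmul_ne_zero L f x₀ hx₀)).exists
  exact ⟨N, hN.1, hN.2⟩

/-! ### The dictionary record: the setup block of `SupplyElementary.supply₁/₂_of_lattice` -/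

/-- The data `(Λ, ℓ, hℓ0, hℓ, F, hF, hF0)` demanded by `SupplyElementary.supply₁/₂_of_lattice`
(and by the fields `Λ … hF0` of `SupplyDictionary.SupplyBridge`), PRODUCED from a Schwartz function
`f`, a discrete lattice `L` and a point `x₀` with `f x₀ ≠ 0`:  `Λ := L`, `F v := f (x₀ + v)`. -/
theorem latticeSetup (f : 𝓢(E, F)) (x₀ : E) (hx₀ : f x₀ ≠ 0) :
    ∃ ℓ : L → ℕ, (∀ v, ℓ v = 0 ↔ v = 0) ∧ (∀ (N : ℕ) (v : L), ℓ (N • v) = N * ℓ v) ∧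
      Summable (fun v : L => ‖f (x₀ + (v : E))‖) ∧ f (x₀ + ((0 : L) : E)) ≠ 0 := by
  obtain ⟨ℓ, hℓ0, hℓ⟩ := exists_latticeSize L
  exact ⟨ℓ, hℓ0, hℓ, summable_norm_translate L f x₀, by simpa using hx₀⟩

end Lattice

end LatticeTheta
end PerL34
end HodgeCM

end

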